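import Mathlib
import Literature.AlgebraicGeometry.Resolution.NonRationalRealization
import Literature.AlgebraicGeometry.Resolution.VertexDissolution
import HarnessLib

/-!
# Realisation for SHIFTED systems at a non-rational near point

Topic: `Literature/AlgebraicGeometry/Resolution`. The computational core of the solvable case of
the non-rational point step (Cossart–Jannsen–Saito, LNM 2270, Ch. 14 = arXiv 0905.2191 §13,
proof of Lemma 14.8: (14.19)–(14.26), «`f′_i = F̃_i(z′) + Σ (z′ − µ)^B (φ′)^{(n_i−|B|)β′ + c_i(B)}
u₁^{(n_i−|B|)(δ−1)} r′_{i,B} + h′` … there is a vertex of `Δ(f′, z′, (u₁, φ′))` on the line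
`{a₁ = δ − 1}`»; Cossart–Piltant 2008, proof of Lemma 4.5 (2), (20)–(24): «Changing `z′` to `w′`
induces an automorphism … `Φ(U′₁, v′, Z′) ↦ Φ(U′₁, v′, W′ − Θ′(U′₁, v′))`»), in the expansion-free
language of `NonRationalChart` / `NonRationalRealization`, for the SHIFTED systems
`cs = (y′ + u₁′^{a₀} Ψ(t), u₁′, P(t))`, `Ψ ∈ R[T]`, `δ = a₀ + 1 ∈ ℕ`. PROVED (no facts):

* `nrShiftCoeff G Ψ μ j = Σ_n C(n+j, j) G_{n+j} (−Ψ)^n` — the coefficients of `Σ_b G_b (Y − Ψ)^b`;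
  `map_nrShiftCoeff`, `natDegree_nrShiftCoeff_le`, `nrShiftCoeff_self`, and the Taylor identity
  `taylor_coeff_shift` for `H(Y) = Σ_b G_b(t) U^{(μ−b)e} Y^b`;
* `nrFam F μ δs` — the line family of a representative (`facePoly_b` for `b < μ`, `γ` at `b = μ`);
* `exists_pts_line_nr_shift_of_rep` — **realisation for the shifted system**: if some shifted line
  coefficient `G^Ψ_j`, `j < μ`, of a unit representative of `f ∈ J` has nonzero reduction, the weak
  transform has, for `cs`, a Newton point ON the line `x₁ = δ − 1` with
  `d · x₂ ≤ max(γ⁺s, L · deg Ψ̄)` (the degree count of CJS Lemma 14.11; steep weight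
  `(Ñ L a₀ + m⋆, L Ñ, L)` as in `exists_pts_nr_face`, which is the case `Ψ = 0`).

AI-written; weaker than expert review.

## Sources

* V. Cossart, U. Jannsen, S. Saito, LNM 2270 (2020), Ch. 14, Lemma 14.8, (14.19)–(14.26), Lemma 14.11.
  [CossartJannsenSaito2020]
* V. Cossart, O. Piltant, J. Algebra 320 (2008), proof of Lemma 4.5 (2), (20)–(24). [CossartPiltant2008]
-/

noncomputable section

open IsLocalRing MvPolynomial

namespace Literature.AlgebraicGeometry.Resolution

universe u

/-! ## Shifted coefficients of a family of polynomials -/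

section ShiftCoeff

variable {S : Type u} [CommRing S]

/-- The shifted coefficients `G^Ψ_j = Σ_{n ≤ μ − j} C(n+j, j) G_{n+j} (−Ψ)^n` of a family
`(G_b)_{b ≤ μ}`: the coefficients of `Σ_b G_b (Y − Ψ)^b`. [cite: CossartJannsenSaito2020, (14.19)–(14.24)] -/
def nrShiftCoeff (G : ℕ → Polynomial S) (Ψ : Polynomial S) (μ j : ℕ) : Polynomial S :=
  ∑ n ∈ Finset.range (μ + 1 - j), (((n + j).choose j : ℕ) : Polynomial S) * G (n + j) * (-Ψ) ^ n

/-- `nrShiftCoeff` commutes with ring maps. [cite: CossartJannsenSaito2020, (14.19)–(14.24)] -/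
theorem map_nrShiftCoeff {S' : Type u} [CommRing S'] (f : S →+* S') (G : ℕ → Polynomial S)
    (Ψ : Polynomial S) (μ j : ℕ) :
    Polynomial.map f (nrShiftCoeff G Ψ μ j) = nrShiftCoeff (fun b => Polynomial.map f (G b)) (Polynomial.map f Ψ) μ j := by
  simp only [nrShiftCoeff, Polynomial.map_sum, Polynomial.map_mul, Polynomial.map_pow,
    Polynomial.map_neg, Polynomial.map_natCast]

/-- Degree bound for the shifted coefficients (the count of CJS Lemma 14.11). [cite: CossartJannsenSaito2020, Lemma 14.11] -/
theorem natDegree_nrShiftCoeff_le (G : ℕ → Polynomial S) (Ψ : Polynomial S) (μ j : ℕ) {A : ℕ → ℕ}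
    (hA : ∀ b, (G b).natDegree ≤ A b) {K : ℕ}
    (hK : ∀ n, n + j ≤ μ → A (n + j) + n * Ψ.natDegree ≤ K) :
    (nrShiftCoeff G Ψ μ j).natDegree ≤ K := by
  refine Polynomial.natDegree_sum_le_of_forall_le _ _ fun n hn => ?_
  have hnj : n + j ≤ μ := by have := Finset.mem_range.mp hn; omega
  calc ((((n + j).choose j : ℕ) : Polynomial S) * G (n + j) * (-Ψ) ^ n).natDegree
      ≤ ((((n + j).choose j : ℕ) : Polynomial S) * G (n + j)).natDegree + ((-Ψ) ^ n).natDegree :=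
        Polynomial.natDegree_mul_le
    _ ≤ A (n + j) + n * Ψ.natDegree := by
        have h1 : ((((n + j).choose j : ℕ) : Polynomial S) * G (n + j)).natDegree ≤ A (n + j) :=
          Polynomial.natDegree_mul_le.trans (by rw [Polynomial.natDegree_natCast, zero_add]; exact hA _)
        have h2 : ((-Ψ) ^ n).natDegree ≤ n * Ψ.natDegree := by
          have := Polynomial.natDegree_pow_le (p := -Ψ) (n := n)
          rwa [Polynomial.natDegree_neg] at this
        omega
    _ ≤ K := hK n hnj

/-- The top shifted coefficient is `G_μ`. [cite: CossartJannsenSaito2020, (14.19)–(14.24)] -/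
theorem nrShiftCoeff_self (G : ℕ → Polynomial S) (Ψ : Polynomial S) (μ : ℕ) :
    nrShiftCoeff G Ψ μ μ = G μ := by
  rw [nrShiftCoeff, show μ + 1 - μ = 1 by omega, Finset.sum_range_one]
  simp

/-- **The shift identity**: for `H(Y) = Σ_{b ≤ μ} G_b(t) U^{(μ−b) e} Y^b` over a ring with elements
`U, ψ`, the coefficients of `H(Y − U^e ψ)` are `U^{(μ−j) e} · G^Ψ_j(t)` where `Ψ(t) = ψ`.
[cite: CossartJannsenSaito2020, (14.21)–(14.24)] -/
theorem taylor_coeff_shift {S' : Type u} [CommRing S'] (f : S →+* S') (t : S') (G : ℕ → Polynomial S)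
    (Ψ : Polynomial S) (μ e : ℕ) (U : S') (j : ℕ) (hj : j ≤ μ) :
    (Polynomial.taylor (-(U ^ e * Polynomial.eval₂ f t Ψ))
        (∑ b ∈ Finset.range (μ + 1), Polynomial.C (Polynomial.eval₂ f t (G b) * U ^ ((μ - b) * e)) *
          Polynomial.X ^ b)).coeff j =
      U ^ ((μ - j) * e) * Polynomial.eval₂ f t (nrShiftCoeff G Ψ μ j) := by
  classical
  set H : Polynomial S' := ∑ b ∈ Finset.range (μ + 1),
    Polynomial.C (Polynomial.eval₂ f t (G b) * U ^ ((μ - b) * e)) * Polynomial.X ^ b with hH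
  have hHcoeff : ∀ i, H.coeff i = if i ≤ μ then Polynomial.eval₂ f t (G i) * U ^ ((μ - i) * e) else 0 := by
    intro i
    rw [hH, Polynomial.finsetSum_coeff]
    simp only [Polynomial.coeff_C_mul_X_pow]
    split_ifs with hi
    · rw [Finset.sum_eq_single i]
      · rw [if_pos rfl]
      · intro b _ hb; rw [if_neg (Ne.symm hb)]
      · intro h; exact absurd (Finset.mem_range.mpr (by omega)) h
    · refine Finset.sum_eq_zero fun b hb => ?_
      rw [if_neg]
      intro h; subst h; exact hi (by have := Finset.mem_range.mp hb; omega)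
  have hHdeg : H.natDegree ≤ μ := by
    refine Polynomial.natDegree_sum_le_of_forall_le _ _ fun b hb => ?_
    have := Finset.mem_range.mp hb
    exact (Polynomial.natDegree_C_mul_X_pow_le _ _).trans (by omega)
  rw [Polynomial.taylor_coeff]
  have hdeg : (Polynomial.hasseDeriv j H).natDegree < μ + 1 - j := by
    have := Polynomial.natDegree_hasseDeriv_le H j
    omega
  rw [Polynomial.eval_eq_sum_range' hdeg, nrShiftCoeff, Polynomial.eval₂_finsetSum, Finset.mul_sum]
  refine Finset.sum_congr rfl fun n hn => ?_
  have hnj : n + j ≤ μ := by have := Finset.mem_range.mp hn; omega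
  rw [Polynomial.hasseDeriv_coeff, hHcoeff, if_pos hnj, Polynomial.eval₂_mul, Polynomial.eval₂_mul,
    Polynomial.eval₂_natCast, Polynomial.eval₂_pow, Polynomial.eval₂_neg]
  have hpow : U ^ ((μ - j) * e) = U ^ ((μ - (n + j)) * e) * U ^ (n * e) := by
    rw [← pow_add]; congr 1
    have : μ - j = (μ - (n + j)) + n := by omega
    rw [this, add_mul]
  rw [hpow, neg_pow, neg_pow, mul_pow, pow_mul]
  ring

end ShiftCoeff


/-! ## The line family of a representative -/

section Family

variable {R : Type u} [CommRing R]

/-- The line family of a representative `F`: `G_b = facePoly_b` for `b < μ` and `G_μ = γ = F_{(μ,0,0)}`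
(the `Y^μ`-coefficient). [cite: CossartPiltant2008, (19)] -/
def nrFam (F : MvPolynomial (Fin 3) R) (μ δs : ℕ) (b : ℕ) : Polynomial R :=
  if b < μ then facePoly F μ δs b else Polynomial.C (F.coeff (Finsupp.single 0 μ))

/-- `G_b = facePoly_b` for `b < μ`. [cite: CossartPiltant2008, (19)] -/
theorem nrFam_of_lt {F : MvPolynomial (Fin 3) R} {μ δs b : ℕ} (hb : b < μ) :
    nrFam F μ δs b = facePoly F μ δs b := if_pos hb

/-- `G_μ = γ`. [cite: CossartPiltant2008, (19)] -/
theorem nrFam_self (F : MvPolynomial (Fin 3) R) (μ δs : ℕ) :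
    nrFam F μ δs μ = Polynomial.C (F.coeff (Finsupp.single 0 μ)) := if_neg (lt_irrefl μ)

end Family

/-! ## Realisation for the shifted system -/

section RealizeShift

variable {R R' : Type u} [CommRing R] [CommRing R'] (φ : R →+* R') {c : Fin 3 → R}
  {c' : Fin 3 → R'} (h₁ : c' 1 = φ (c 1)) (h₀ : φ (c 0) = φ (c 1) * c' 0) {t : R'}
  (ht : φ (c 2) = φ (c 1) * t) {P : Polynomial R} (hP : c' 2 = Polynomial.eval₂ φ t P)
  [IsRegularLocalRing R] [IsRegularLocalRing R']
  (hgen : Ideal.span {c 0, c 1, c 2} = maximalIdeal R) (hdim : ringKrullDim R = 3)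
  (hgen' : Ideal.span {c' 0, c' 1, c' 2} = maximalIdeal R') (hdim' : ringKrullDim R' = 3)
  (hres : ∀ G : Polynomial R, Polynomial.eval₂ φ t G ∈ maximalIdeal R' ↔
    Polynomial.map (residue R) P ∣ Polynomial.map (residue R) G)
  {J : Ideal R} {μ : ℕ}

/-- The precision needed for the realisation with bound `Γ′`. [cite: CossartJannsenSaito2020, Lemma 14.8] -/
def nrPrecision (μ δs Γ' : ℕ) : ℕ := ((Γ' * μ + 1) * δs + Γ') * μ + μ + 1

include h₁ h₀ ht hP hgen hdim hgen' hdim' hres in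
/-- **Realisation for the shifted system** `cs = (y′ + u₁′^{a₀} Ψ(t), u₁′, P(t))` (`δ = a₀ + 1 ∈ ℕ`),
element-wise (CJS (14.21)–(14.26); CoP1 (20)–(24)): let `f ∈ J ⊆ 𝔪^μ`, `F` a unit representative of
`f` to precision `≥ nrPrecision μ δs Γ′`, `Γ′ = max(γ⁺s, L·D)`, `deg Ψ̄ ≤ D`, `d = deg P̄ ≥ 1`. If some
shifted line coefficient `G^Ψ_j` (`j < μ`) of `F` has nonzero reduction, then the weak transform
`J′` has a Newton point for `cs` ON the line `x₁ = δ − 1` with `d · x₂ ≤ Γ′` (scaled).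
[cite: CossartJannsenSaito2020, Lemma 14.8, (14.24)–(14.26)] [cite: CossartPiltant2008, Lemma 4.5 (2), (20)–(24)] -/
theorem exists_pts_line_nr_shift_of_rep (hPu : ¬ IsUnit (Polynomial.map (residue R) P))
    (hd : 1 ≤ (Polynomial.map (residue R) P).natDegree)
    (hJμ : J ≤ maximalIdeal R ^ μ) (hδ : μ.factorial < deltaS c J μ)
    {a₀ : ℕ} (ha₀ : deltaS c J μ = μ.factorial * (a₀ + 1)) (Ψ : Polynomial R) {D : ℕ}
    (hD : (Polynomial.map (residue R) Ψ).natDegree ≤ D)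
    {f : R} (hfJ : f ∈ J) {M : ℕ}
    (hM : nrPrecision μ (deltaS c J μ) (max (gammaPlusS c J μ) (μ.factorial * D)) ≤ M)
    {F : MvPolynomial (Fin 3) R} (hFu : HasUnitCoeffs F) (hFrem : f - eval c F ∈ maximalIdeal R ^ M)
    {j₀ : ℕ} (hj₀ : j₀ < μ)
    (hne0 : Polynomial.map (residue R) (nrShiftCoeff (nrFam F μ (deltaS c J μ)) Ψ μ j₀) ≠ 0) :
    ∃ e ∈ pts (shiftZ c' (shiftMon c' (Polynomial.eval₂ φ t Ψ) a₀ 0))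
        (Submodule.colon (Ideal.map φ J) ({φ (c 1) ^ μ} : Set R')) μ,
      spt₁ μ e + μ.factorial = deltaS c J μ ∧
      (Polynomial.map (residue R) P).natDegree * spt₂ μ e ≤
        max (gammaPlusS c J μ) (μ.factorial * D) := by
  classical
  -- notation
  set J' := Submodule.colon (Ideal.map φ J) ({φ (c 1) ^ μ} : Set R') with hJ'
  set δs := deltaS c J μ with hδs
  set L := μ.factorial with hL
  set Γ' := max (gammaPlusS c J μ) (L * D) with hΓ'
  set d := (Polynomial.map (residue R) P).natDegree with hd'
  set ψ := Polynomial.eval₂ φ t Ψ with hψ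
  set cs := shiftZ c' (shiftMon c' ψ a₀ 0) with hcs
  set G := nrFam F μ δs with hG
  have hLpos : 0 < L := Nat.factorial_pos μ
  have hgenr := span_range_eq_of_span_triple c hgen
  have hgenr' := span_range_eq_of_span_triple c' hgen'
  have hδpos : 0 < δs := by omega
  have ha₀L : δs - L = L * a₀ := by rw [ha₀, Nat.mul_succ]; omega
  have ha₀pos : 0 < a₀ := by
    by_contra h0
    have : a₀ = 0 := by omega
    rw [this, zero_add, mul_one] at ha₀; omega
  have hcs0 : cs 0 = c' 0 + ψ * c' 1 ^ a₀ := by simp [hcs, shiftZ, shiftMon]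
  have hcs1 : cs 1 = c' 1 := rfl
  have hcs2 : cs 2 = c' 2 := rfl
  have hgencs : Ideal.span {cs 0, cs 1, cs 2} = maximalIdeal R' := by
    rw [hcs, span_triple_shiftZ c' ψ (by omega : 0 < a₀ + 0)]; exact hgen'
  have hgenrcs := span_range_eq_of_span_triple cs hgencs
  -- the face weight on `R`
  set w : Fin 3 → ℕ := levelWeight μ δs 1 1 with hwdef
  have hw : ∀ i, 0 < w i := levelWeight_pos hδpos Nat.one_pos Nat.one_pos
  have hJw : J ≤ weightedIdealW c w (δs * μ) :=
    (le_weightedIdealW_levelWeight_iff c hgen hdim J hδpos Nat.one_pos Nat.one_pos).mpr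
      (fun e he => by simpa using deltaS_le he)
  -- constants
  set Ntil := Γ' * μ + 1 with hNtil
  set Λ := (Ntil * δs + Γ') * μ with hΛ
  have hMΛ : Λ + μ + 1 ≤ M := by rw [hΛ, hNtil]; exact hM
  have hremw : f - eval c F ∈ weightedIdealW c w M := pow_maximalIdeal_le_weightedIdealW c hgenr hw M hFrem
  have hrem1 : f - eval c F ∈ weightedIdealW c (fun _ => 1) M :=
    pow_maximalIdeal_le_weightedIdealW c hgenr (fun _ => Nat.one_pos) M hFrem
  have hδμΛ : δs * μ ≤ Λ := by
    rw [hΛ]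
    have : δs ≤ Ntil * δs + Γ' := by
      have : 1 * δs ≤ Ntil * δs := Nat.mul_le_mul_right _ (by omega)
      omega
    exact Nat.mul_le_mul_right _ this
  -- (a) all monomials of `F` have degree `≥ μ`
  have hdeg : ∀ m ∈ F.support, μ ≤ m 0 + m 1 + m 2 := by
    have hf1 : f ∈ weightedIdealW c (fun _ => 1) μ := by rw [weightedIdealW_one_eq_pow c hgenr]; exact hJμ hfJ
    intro m hm
    have := (mem_weightedIdealW_iff_of_unitRep c hgen hdim (fun _ => Nat.one_pos) hFu hrem1 (by omega)).mp
      hf1 m hm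
    rwa [weight_one_eq] at this
  -- (b) `w`-weights `≥ δs μ`; face monomials
  have hminw : ∀ m ∈ F.support, δs * μ ≤ Finsupp.weight w m :=
    (mem_weightedIdealW_iff_of_unitRep c hgen hdim hw hFu hremw (by omega)).mp (hJw hfJ)
  have hface_ge : ∀ m ∈ F.support, m 0 < μ → δs ≤ spt₁ μ m + spt₂ μ m := by
    intro m hm hm0
    have := (le_weight_levelWeight_iff hm0 δs 1 1).mp (hminw m hm)
    simpa using this
  have hface_pts : ∀ m ∈ F.support, m 0 < μ → spt₁ μ m + spt₂ μ m = δs → m ∈ pts c J μ := by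
    intro m hm hm0 hsum
    have hwt : Finsupp.weight w m = δs * μ := by
      rw [hwdef, (weight_levelWeight_eq_iff_spt hm0 δs 1 1).mpr (by simpa using hsum)]
    have hinit : IsInitialTerm c w f m := by
      refine (isInitialTerm_iff_of_unitRep c hgen hdim hw hFu hremw (by omega)).mpr ⟨hm, ?_⟩
      intro m' hm'; rw [hwt]; exact hminw m' hm'
    exact ⟨mem_occ_of_isInitialTerm c hfJ hw hinit, hm0⟩
  have hL' : ∀ {m : Fin 3 →₀ ℕ}, m 0 < μ → (μ - m 0) * sfac μ m = L := fun hm => sub_mul_sfac hm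
  -- face monomials of `y`-degree `b` have `m₁ + m₂ = (μ − b)(a₀ + 1)`
  have hface_sum : ∀ b, ∀ m ∈ faceSet F μ δs b, m 1 + m 2 = (μ - b) * (a₀ + 1) := by
    intro b m hm
    obtain ⟨-, hb0, hlt, hsum⟩ := mem_faceSet.mp hm
    have hs := add_mul_sfac_of_mem_faceSet hm
    have hLb := hL' hlt
    rw [hb0] at hLb
    have hpos : 0 < sfac μ m := sfac_pos hlt
    apply Nat.eq_of_mul_eq_mul_right hpos
    rw [hs, ha₀, ← hLb]; ring
  -- degree bounds for the family: `L · deg Ḡ_b ≤ (μ − b) γ⁺s`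
  have hGdeg : ∀ b, L * (Polynomial.map (residue R) (G b)).natDegree ≤ (μ - b) * gammaPlusS c J μ := by
    intro b
    by_cases hb : b < μ
    · rw [hG, nrFam_of_lt hb]
      by_cases hne : (faceSet F μ δs b).Nonempty
      · obtain ⟨mx, hmx, hmxmax⟩ := Finset.exists_max_image (faceSet F μ δs b) (fun m => m 2) hne
        have h1 : (Polynomial.map (residue R) (facePoly F μ δs b)).natDegree ≤ mx 2 :=
          Polynomial.natDegree_map_le.trans (natDegree_facePoly_le hmxmax)
        obtain ⟨hmxs, hb0, hlt, hsum⟩ := mem_faceSet.mp hmx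
        have h2 : spt₂ μ mx ≤ gammaPlusS c J μ := le_gammaPlusS (hface_pts mx hmxs hlt hsum) hsum
        rw [spt₂] at h2
        have hLb := hL' hlt
        rw [hb0] at hLb
        calc L * (Polynomial.map (residue R) (facePoly F μ δs b)).natDegree ≤ L * mx 2 :=
              Nat.mul_le_mul_left _ h1
          _ = (μ - b) * (mx 2 * sfac μ mx) := by rw [← hLb]; ring
          _ ≤ (μ - b) * gammaPlusS c J μ := Nat.mul_le_mul_left _ h2
      · have : facePoly F μ δs b = 0 := by
          rw [facePoly, Finset.not_nonempty_iff_eq_empty.mp hne, Finset.sum_empty]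
        rw [this, Polynomial.map_zero, Polynomial.natDegree_zero, mul_zero]; exact Nat.zero_le _
    · rw [hG, nrFam, if_neg hb, Polynomial.map_C, Polynomial.natDegree_C, mul_zero]; exact Nat.zero_le _
  have hSCdeg : ∀ j, j < μ → L * (Polynomial.map (residue R) (nrShiftCoeff G Ψ μ j)).natDegree ≤ (μ - j) * Γ' := by
    intro j hj
    rw [map_nrShiftCoeff]
    have hK : (nrShiftCoeff (fun b => Polynomial.map (residue R) (G b)) (Polynomial.map (residue R) Ψ) μ j).natDegree
        ≤ (μ - j) * Γ' / L := by
      refine natDegree_nrShiftCoeff_le _ _ μ j (A := fun b => (Polynomial.map (residue R) (G b)).natDegree)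
        (fun b => le_rfl) fun n hnj => ?_
      rw [Nat.le_div_iff_mul_le hLpos]
      have h1 := hGdeg (n + j)
      have h2 : L * (n * (Polynomial.map (residue R) Ψ).natDegree) ≤ n * Γ' := by
        calc L * (n * (Polynomial.map (residue R) Ψ).natDegree) = n * (L * (Polynomial.map (residue R) Ψ).natDegree) := by ring
          _ ≤ n * (L * D) := Nat.mul_le_mul_left _ (Nat.mul_le_mul_left _ hD)
          _ ≤ n * Γ' := Nat.mul_le_mul_left _ (le_max_right _ _)
      have h3 : (μ - (n + j)) * gammaPlusS c J μ ≤ (μ - (n + j)) * Γ' := Nat.mul_le_mul_left _ (le_max_left _ _)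
      have h4 : (μ - (n + j)) * Γ' + n * Γ' = (μ - j) * Γ' := by rw [← Nat.add_mul]; congr 1; omega
      rw [Nat.mul_comm, Nat.mul_add]
      omega
    have := (Nat.le_div_iff_mul_le hLpos).mp hK
    rw [Nat.mul_comm] at this; exact this
  -- the set `Bs` of `y`-degrees with a nonzero shifted coefficient, and the factorisation data
  set Bs : Finset ℕ := (Finset.range μ).filter (fun b => Polynomial.map (residue R) (nrShiftCoeff G Ψ μ b) ≠ 0)
    with hBs
  have hBs_ne : Bs.Nonempty := ⟨j₀, Finset.mem_filter.mpr ⟨Finset.mem_range.mpr hj₀, hne0⟩⟩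
  have hfac : ∀ b ∈ Bs, ∃ (s : ℕ) (v r : R'), IsUnit v ∧
      Polynomial.eval₂ φ t (nrShiftCoeff G Ψ μ b) = c' 2 ^ s * v + φ (c 1) * r ∧
      s * d ≤ (Polynomial.map (residue R) (nrShiftCoeff G Ψ μ b)).natDegree := by
    intro b hb
    obtain ⟨-, hne⟩ := Finset.mem_filter.mp hb
    exact exists_pow_mul_unit_add φ hgen h₀ ht hP hres hPu hne
  choose! sOf vOf rOf hvOf hevalOf hsdOf using hfac
  let val : ℕ → ℕ := fun b => sOf b * (L / (μ - b))
  obtain ⟨bst, hbst, hbmin⟩ := Finset.exists_min_image Bs val hBs_ne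
  have hBs_lt : ∀ b ∈ Bs, b < μ := fun b hb => Finset.mem_range.mp (Finset.mem_filter.mp hb).1
  have hbst_lt : bst < μ := hBs_lt bst hbst
  set mstar := val bst with hmstar
  have hsfac_eq : ∀ b, b < μ → (μ - b) * (L / (μ - b)) = L := by
    intro b hb
    rw [mul_comm]; exact Nat.div_mul_cancel (Nat.dvd_factorial (by omega) (by omega))
  have hval : ∀ b ∈ Bs, (μ - b) * val b = L * sOf b := by
    intro b hb
    show (μ - b) * (sOf b * (L / (μ - b))) = L * sOf b
    rw [mul_comm (sOf b), ← mul_assoc, hsfac_eq b (hBs_lt b hb)]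
  -- `d · val b ≤ Γ′`, hence `val b ≤ Γ′`
  have hvalΓd : ∀ b ∈ Bs, d * val b ≤ Γ' := by
    intro b hb
    have hb' := hBs_lt b hb
    have h1 : L * (sOf b * d) ≤ (μ - b) * Γ' :=
      (Nat.mul_le_mul_left _ (hsdOf b hb)).trans (hSCdeg b hb')
    have h2 : (μ - b) * (d * val b) = L * (sOf b * d) := by
      calc (μ - b) * (d * val b) = d * ((μ - b) * val b) := by ring
        _ = d * (L * sOf b) := by rw [hval b hb]
        _ = L * (sOf b * d) := by ring
    have hpos : 0 < μ - b := by omega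
    rw [← h2] at h1
    exact Nat.le_of_mul_le_mul_left h1 hpos
  have hvalΓ : ∀ b ∈ Bs, val b ≤ Γ' := by
    intro b hb
    have := hvalΓd b hb
    have h1 : 1 * val b ≤ d * val b := Nat.mul_le_mul_right _ hd
    omega
  have hmstarΓ : mstar ≤ Γ' := hvalΓ bst hbst
  have hNtil_gt : μ * mstar + 1 ≤ Ntil := by
    rw [hNtil]
    have : μ * mstar ≤ Γ' * μ := by rw [mul_comm Γ']; exact Nat.mul_le_mul_left μ hmstarΓ
    omega
  -- the steep weight on `R′` (for the system `cs`)
  set w0' := Ntil * (δs - L) + mstar with hw0'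
  set w' : Fin 3 → ℕ := levelWeight μ w0' Ntil 1 with hw'def
  have hw0'pos : 0 < w0' := by
    rw [hw0', ha₀L]
    have : 1 * 1 ≤ Ntil * (L * a₀) := Nat.mul_le_mul (by omega) (Nat.mul_pos hLpos ha₀pos)
    omega
  have hw' : ∀ i, 0 < w' i := levelWeight_pos hw0'pos (by omega) Nat.one_pos
  set ℓ := w0' * μ with hℓ
  set T := ℓ + 1 + μ * (L * Ntil) with hT
  have hwt' : ∀ e : Fin 3 →₀ ℕ, Finsupp.weight w' e = w0' * e 0 + L * (Ntil * e 1 + 1 * e 2) :=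
    fun e => weight_levelWeight μ w0' Ntil 1 e
  have hw0'eq : w0' = Ntil * (L * a₀) + mstar := by rw [hw0', ha₀L]
  -- the candidate exponents `e_b = (b, (μ − b) a₀, s_b)`
  let eOf : ℕ → Fin 3 →₀ ℕ := fun b => ybexp b ((μ - b) * a₀) (sOf b)
  have hweOf : ∀ b ∈ Bs, Finsupp.weight w' (eOf b) + (μ - b) * mstar = ℓ + (μ - b) * val b := by
    intro b hb
    have hb_lt := hBs_lt b hb
    have h2 := hval b hb
    rw [hwt' (eOf b)]
    simp only [eOf, ybexp_apply, Matrix.cons_val_zero, Matrix.cons_val_one, Matrix.cons_val_two,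
      Matrix.head_cons, Matrix.tail_cons, one_mul]
    rw [hℓ, hw0'eq]
    have hsplit : (Ntil * (L * a₀) + mstar) * μ = (Ntil * (L * a₀) + mstar) * b + (Ntil * (L * a₀) + mstar) * (μ - b) := by
      rw [← Nat.mul_add]; congr 1; omega
    rw [hsplit]
    have : L * (Ntil * ((μ - b) * a₀) + sOf b) = Ntil * (L * a₀) * (μ - b) + L * sOf b := by ring
    rw [this, ← h2]
    ring
  have hweOf_ge : ∀ b ∈ Bs, ℓ ≤ Finsupp.weight w' (eOf b) := by
    intro b hb
    have := hweOf b hb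
    have hmin := hbmin b hb
    have : (μ - b) * mstar ≤ (μ - b) * val b := Nat.mul_le_mul_left _ hmin
    omega
  have hweOf_eq : ∀ b ∈ Bs, val b = mstar → Finsupp.weight w' (eOf b) = ℓ := by
    intro b hb hv
    have := hweOf b hb
    rw [hv] at this
    omega
  have hweOf_gt : ∀ b ∈ Bs, val b ≠ mstar → ℓ + 1 ≤ Finsupp.weight w' (eOf b) := by
    intro b hb hv
    have hb_lt := hBs_lt b hb
    have := hweOf b hb
    have hmin := hbmin b hb
    have hlt : mstar + 1 ≤ val b := by omega
    have : (μ - b) * (mstar + 1) ≤ (μ - b) * val b := Nat.mul_le_mul_left _ hlt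
    rw [Nat.mul_add, mul_one] at this
    have hμb : 1 ≤ μ - b := by omega
    omega
  -- the element `g` of the weak transform
  obtain ⟨g, hg⟩ := exists_eq_pow_mul_of_mem_pow φ (c' := ![c' 0, c' 1, t]) (by simpa using h₀)
    (by simpa using ht) hgen (hJμ hfJ)
  have hgJ' : g ∈ J' := by
    rw [Submodule.mem_colon_singleton, smul_eq_mul, mul_comm, ← hg]; exact Ideal.mem_map_of_mem _ hfJ
  -- the polynomial `F⋆` (coordinates `cs`)
  set Fst : MvPolynomial (Fin 3) R' :=
    (∑ b ∈ Bs, if val b = mstar then monomial (eOf b) (vOf b) else 0) +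
      monomial (Finsupp.single 0 μ) (φ (F.coeff (Finsupp.single 0 μ))) with hFst
  have hwt_single0 : Finsupp.weight w' (Finsupp.single 0 μ) = ℓ := by
    rw [Finsupp.weight_apply, Finsupp.sum_single_index (by simp), smul_eq_mul, hℓ, mul_comm]
    simp [hw'def]
  have hFst_hom : Fst.IsWeightedHomogeneous w' ℓ := by
    refine IsWeightedHomogeneous.add (IsWeightedHomogeneous.sum _ _ _ fun b hb => ?_)
      (isWeightedHomogeneous_monomial _ _ _ hwt_single0)
    by_cases hv : val b = mstar
    · rw [if_pos hv]; exact isWeightedHomogeneous_monomial _ _ _ (hweOf_eq b hb hv)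
    · rw [if_neg hv]; exact isWeightedHomogeneous_zero _ _ _
  have heOf_inj : ∀ b b', eOf b = eOf b' → b = b' := fun b b' h => by
    have := congrArg (fun e => e 0) h; simpa [eOf] using this
  have hFst_coeff : Fst.coeff (eOf bst) = vOf bst := by
    rw [hFst, coeff_add, coeff_sum, coeff_monomial, if_neg, add_zero]
    · rw [Finset.sum_eq_single bst]
      · rw [if_pos hmstar.symm, coeff_monomial, if_pos rfl]
      · intro b _ hne
        by_cases hv : val b = mstar
        · rw [if_pos hv, coeff_monomial, if_neg (fun h => hne (heOf_inj _ _ h))]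
        · rw [if_neg hv, coeff_zero]
      · intro h; exact absurd hbst h
    · intro h
      have := congrArg (fun e => e 0) h
      simp [eOf] at this
      omega
  -- the threshold ideal `F′_T` (for `cs`) and its basic members
  have hmon_mem : ∀ e : Fin 3 →₀ ℕ, ∀ x y : R', T ≤ Finsupp.weight w' e →
      x * monom3 cs e * y ∈ weightedIdealW cs w' T := by
    intro e x y he
    exact Ideal.mul_mem_right _ _ (Ideal.mul_mem_left _ _
      (weightedIdealW_antitone cs w' he (monomial_mem_weightedIdealW cs w' le_rfl)))
  have hu1_mem : ∀ n, c' 1 ^ n ∈ weightedIdealW cs w' (n * (L * Ntil)) := by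
    intro n
    have : c' 1 ^ n = monom3 cs (Finsupp.single 1 n) := by simp [monom3, hcs1]
    rw [this]
    refine monomial_mem_weightedIdealW cs w' (le_of_eq ?_)
    rw [Finsupp.weight_apply, Finsupp.sum_single_index (by simp), smul_eq_mul]
    simp [hw'def, hL]
  -- `y′ = cs₀ − ψ u₁′^{a₀} ∈ F′_{w0′ − mstar}`
  have hy'mem : c' 0 ∈ weightedIdealW cs w' (Ntil * (L * a₀)) := by
    have h1 : cs 0 ∈ weightedIdealW cs w' (Ntil * (L * a₀)) := by
      have : cs 0 = monom3 cs (Finsupp.single 0 1) := by simp [monom3]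
      rw [this]
      refine monomial_mem_weightedIdealW cs w' ?_
      rw [Finsupp.weight_apply, Finsupp.sum_single_index (by simp), smul_eq_mul, one_mul]
      show Ntil * (L * a₀) ≤ w' 0
      simp only [hw'def, levelWeight_zero, hw0'eq]; omega
    have h2 : ψ * c' 1 ^ a₀ ∈ weightedIdealW cs w' (Ntil * (L * a₀)) := by
      refine Ideal.mul_mem_left _ _ ?_
      have := hu1_mem a₀
      rw [show a₀ * (L * Ntil) = Ntil * (L * a₀) by ring] at this
      exact this
    have : c' 0 = cs 0 - ψ * c' 1 ^ a₀ := by rw [hcs0]; ring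
    rw [this]; exact Ideal.sub_mem _ h1 h2
  -- the terms of `φ(F(c))`
  let term : (Fin 3 →₀ ℕ) → R' := fun m => φ (F.coeff m) * monom3 c' (nrExp m) * t ^ (m 2)
  have hφF : φ (eval c F) = ∑ m ∈ F.support, term m := by
    conv_lhs => rw [F.as_sum, map_sum, map_sum]
    refine Finset.sum_congr rfl fun m _ => ?_
    rw [eval_monomial_eq_monom3, map_mul, map_monom3_nr φ h₁ h₀ ht]
    show _ = φ (F.coeff m) * monom3 c' (nrExp m) * t ^ (m 2)
    ring
  have hmonom_nr : ∀ m : Fin 3 →₀ ℕ, monom3 c' (nrExp m) = c' 0 ^ (m 0) * c' 1 ^ (m 0 + m 1 + m 2) := by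
    intro m; simp [monom3, nrExp]
  -- (P0) generic bound: a term with `m₀ (w0′ − mstar) + |m| L Ntil ≥ T` lies in `F′_T`
  have hterm_mem : ∀ m : Fin 3 →₀ ℕ, T ≤ m 0 * (Ntil * (L * a₀)) + (m 0 + m 1 + m 2) * (L * Ntil) →
      term m ∈ weightedIdealW cs w' T := by
    intro m hm
    show φ (F.coeff m) * monom3 c' (nrExp m) * t ^ (m 2) ∈ _
    rw [hmonom_nr m]
    refine Ideal.mul_mem_right _ _ (Ideal.mul_mem_left _ _ (weightedIdealW_antitone cs w' hm ?_))
    exact weightedIdealW_mul_le cs w' _ _ (Ideal.mul_mem_mul (pow_mem_weightedIdealW cs w' hy'mem (m 0))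
      (hu1_mem _))
  -- arithmetic: `T − 1 + L Ntil ≤ μ (w0′ − mstar) + (μ + 1) L Ntil`
  have hTarith : T ≤ μ * (Ntil * (L * a₀)) + (μ + 1) * (L * Ntil) := by
    rw [hT, hℓ, hw0'eq]
    have h1 : μ * mstar + 1 ≤ L * Ntil := by
      have : Ntil ≤ L * Ntil := Nat.le_mul_of_pos_left _ hLpos
      omega
    have h2 : (Ntil * (L * a₀) + mstar) * μ = μ * (Ntil * (L * a₀)) + μ * mstar := by ring
    have h3 : (μ + 1) * (L * Ntil) = μ * (L * Ntil) + L * Ntil := by ring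
    rw [h2, h3]
    omega
  -- (P1) non-face monomials with `m₀ < μ`
  have hnonface : ∀ m ∈ F.support, m 0 < μ → spt₁ μ m + spt₂ μ m ≠ δs → term m ∈ weightedIdealW cs w' T := by
    intro m hm hm0 hsum
    refine hterm_mem m (hTarith.trans ?_)
    have hge : δs + 1 ≤ spt₁ μ m + spt₂ μ m := by have := hface_ge m hm hm0; omega
    have hLb := hL' hm0
    -- `L (m₁ + m₂) ≥ (μ − m₀)(δs + 1) = (μ − m₀) L (a₀+1) + (μ − m₀)`
    have hsum1 : (μ - m 0) * (δs + 1) ≤ L * (m 1 + m 2) := by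
      rw [← hLb, mul_assoc]
      refine Nat.mul_le_mul_left _ ?_
      rw [Nat.mul_comm, add_mul, ← spt₁, ← spt₂]; exact hge
    rw [ha₀] at hsum1
    have hm12 : (μ - m 0) * (a₀ + 1) + 1 ≤ m 1 + m 2 := by
      by_contra hlt
      push Not at hlt
      have : L * (m 1 + m 2) ≤ L * ((μ - m 0) * (a₀ + 1)) := Nat.mul_le_mul_left _ (by omega)
      have h2 : (μ - m 0) * (L * (a₀ + 1) + 1) = L * ((μ - m 0) * (a₀ + 1)) + (μ - m 0) := by ring
      have h3 : 1 ≤ μ - m 0 := by omega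
      omega
    obtain ⟨k, hk⟩ : ∃ k, μ = m 0 + k := ⟨μ - m 0, by omega⟩
    have hk' : μ - m 0 = k := by omega
    rw [hk'] at hm12
    have hB := Nat.mul_le_mul_right (L * Ntil) hm12
    rw [hk]
    have e1 : (m 0 + k) * (Ntil * (L * a₀)) + (m 0 + k + 1) * (L * Ntil) =
        m 0 * (Ntil * (L * a₀)) + m 0 * (L * Ntil) + (k * (a₀ + 1) + 1) * (L * Ntil) := by ring
    have e2 : (m 0 + m 1 + m 2) * (L * Ntil) = m 0 * (L * Ntil) + (m 1 + m 2) * (L * Ntil) := by ring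
    rw [e1, e2]
    omega
  -- (P1') monomials with `m₀ ≥ μ` other than `(μ, 0, 0)`
  have hhigh : ∀ m ∈ F.support, μ ≤ m 0 → m ≠ Finsupp.single 0 μ → term m ∈ weightedIdealW cs w' T := by
    intro m hm hm0 hne
    refine hterm_mem m (hTarith.trans ?_)
    have hdegm := hdeg m hm
    have hgt : μ + 1 ≤ m 0 + m 1 + m 2 := by
      by_contra hle
      push Not at hle
      apply hne
      ext i
      fin_cases i
      · simp; omega
      · simp; omega
      · simp; omega
    have h1 : μ * (Ntil * (L * a₀)) ≤ m 0 * (Ntil * (L * a₀)) := Nat.mul_le_mul_right _ hm0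
    have h2 : (μ + 1) * (L * Ntil) ≤ (m 0 + m 1 + m 2) * (L * Ntil) := Nat.mul_le_mul_right _ hgt
    omega
  -- the face part, fibrewise
  let face : (Fin 3 →₀ ℕ) → Prop := fun m => m 0 < μ ∧ spt₁ μ m + spt₂ μ m = δs
  set top : Fin 3 →₀ ℕ := Finsupp.single 0 μ with htop
  have htop_nface : ¬ face top := by rintro ⟨hlt, -⟩; simp [htop] at hlt
  have hfib : ∀ b, (F.support.filter face).filter (fun m => m 0 = b) = faceSet F μ δs b := by
    intro b; ext m; simp only [Finset.mem_filter, faceSet, face]; tauto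
  have hmaps : ∀ m ∈ F.support.filter face, m 0 ∈ Finset.range μ := by
    intro m hm
    exact Finset.mem_range.mpr (Finset.mem_filter.mp hm).2.1
  -- `LINE = Σ_b G_b(t) u₁′^{(μ−b)(a₀+1)} (u₁′ y′)^b`
  let LINE : R' := ∑ b ∈ Finset.range (μ + 1),
    Polynomial.eval₂ φ t (G b) * c' 1 ^ ((μ - b) * (a₀ + 1)) * (c' 1 * c' 0) ^ b
  have hface_b : ∀ b, b < μ → (∑ m ∈ faceSet F μ δs b, term m) =
      Polynomial.eval₂ φ t (G b) * c' 1 ^ ((μ - b) * (a₀ + 1)) * (c' 1 * c' 0) ^ b := by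
    intro b hb
    rw [hG, nrFam_of_lt hb, eval₂_facePoly, Finset.sum_mul, Finset.sum_mul]
    refine Finset.sum_congr rfl fun m hm => ?_
    have hs := hface_sum b m hm
    obtain ⟨-, hb0, -, -⟩ := mem_faceSet.mp hm
    show φ (F.coeff m) * monom3 c' (nrExp m) * t ^ (m 2) = _
    rw [hmonom_nr m, hb0, add_assoc, hs, mul_pow]
    have : c' 1 ^ (b + (μ - b) * (a₀ + 1)) = c' 1 ^ ((μ - b) * (a₀ + 1)) * c' 1 ^ b := by
      rw [← pow_add, add_comm]
    rw [this]; ring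
  have htop_term : term top = Polynomial.eval₂ φ t (G μ) * c' 1 ^ ((μ - μ) * (a₀ + 1)) * (c' 1 * c' 0) ^ μ := by
    rw [hG, nrFam_self, Polynomial.eval₂_C, Nat.sub_self, zero_mul, pow_zero, mul_one]
    show φ (F.coeff top) * monom3 c' (nrExp top) * t ^ (top 2) = _
    rw [hmonom_nr top]
    simp [htop, mul_pow]; ring
  have hLINE : (∑ m ∈ F.support.filter face, term m) + term top = LINE := by
    rw [← Finset.sum_fiberwise_of_maps_to hmaps]
    show (∑ b ∈ Finset.range μ, ∑ m ∈ (F.support.filter face).filter (fun m => m 0 = b), term m) + term top = _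
    simp_rw [hfib]
    show _ = ∑ b ∈ Finset.range (μ + 1),
      Polynomial.eval₂ φ t (G b) * c' 1 ^ ((μ - b) * (a₀ + 1)) * (c' 1 * c' 0) ^ b
    rw [Finset.sum_range_succ, htop_term]
    congr 1
    exact Finset.sum_congr rfl fun b hb => hface_b b (Finset.mem_range.mp hb)
  -- `LINE` via the Taylor expansion at `u₁′ cs₀`
  set Hpol : Polynomial R' := ∑ b ∈ Finset.range (μ + 1),
    Polynomial.C (Polynomial.eval₂ φ t (G b) * c' 1 ^ ((μ - b) * (a₀ + 1))) * Polynomial.X ^ b with hHpol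
  have hLINE_eval : LINE = Polynomial.eval (c' 1 * cs 0 + -(c' 1 ^ (a₀ + 1) * ψ)) Hpol := by
    have hy : c' 1 * cs 0 + -(c' 1 ^ (a₀ + 1) * ψ) = c' 1 * c' 0 := by rw [hcs0]; ring
    rw [hy, hHpol, Polynomial.eval_finsetSum]
    refine Finset.sum_congr rfl fun b _ => ?_
    rw [Polynomial.eval_mul, Polynomial.eval_C, Polynomial.eval_pow, Polynomial.eval_X]
  have hHdeg : Hpol.natDegree ≤ μ := by
    refine Polynomial.natDegree_sum_le_of_forall_le _ _ fun b hb => ?_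
    have := Finset.mem_range.mp hb
    exact (Polynomial.natDegree_C_mul_X_pow_le _ _).trans (by omega)
  let piece : ℕ → R' := fun j =>
    c' 1 ^ ((μ - j) * (a₀ + 1)) * Polynomial.eval₂ φ t (nrShiftCoeff G Ψ μ j) * (c' 1 * cs 0) ^ j
  have hLINE_pieces : LINE = ∑ j ∈ Finset.range (μ + 1), piece j := by
    rw [hLINE_eval, ← Polynomial.taylor_eval]
    have hdeg : (Polynomial.taylor (-(c' 1 ^ (a₀ + 1) * ψ)) Hpol).natDegree < μ + 1 := by
      rw [Polynomial.natDegree_taylor]; omega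
    rw [Polynomial.eval_eq_sum_range' hdeg]
    refine Finset.sum_congr rfl fun j hj => ?_
    have hjμ : j ≤ μ := by have := Finset.mem_range.mp hj; omega
    rw [hHpol, hψ, taylor_coeff_shift φ t G Ψ μ (a₀ + 1) (c' 1) j hjμ]
  -- each piece minus its `F⋆`-part lies in `F′_T`
  have hjunk_wt : ∀ j, j ≤ μ → T ≤ Finsupp.weight w' (ybexp j (μ + (μ - j) * a₀ + 1) 0) := by
    intro j hj
    rw [hwt', hT, hℓ, hw0'eq]
    simp only [ybexp_apply, Matrix.cons_val_zero, Matrix.cons_val_one, Matrix.cons_val_two,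
      Matrix.head_cons, Matrix.tail_cons, mul_zero, add_zero]
    have hsplit : (Ntil * (L * a₀) + mstar) * μ = (Ntil * (L * a₀) + mstar) * j + (Ntil * (L * a₀) + mstar) * (μ - j) := by
      rw [← Nat.mul_add]; congr 1; omega
    rw [hsplit]
    have h1 : (μ - j) * mstar + 1 ≤ L * Ntil := by
      have : (μ - j) * mstar ≤ μ * mstar := Nat.mul_le_mul_right _ (Nat.sub_le _ _)
      have : Ntil ≤ L * Ntil := Nat.le_mul_of_pos_left _ hLpos
      omega
    have h2 : L * (Ntil * (μ + (μ - j) * a₀ + 1)) = μ * (L * Ntil) + (μ - j) * (Ntil * (L * a₀)) + L * Ntil := by ring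
    have h3 : (Ntil * (L * a₀) + mstar) * (μ - j) = (μ - j) * (Ntil * (L * a₀)) + (μ - j) * mstar := by ring
    rw [h2, h3]
    omega
  have hlev : ∀ j, j ≤ μ → (μ - j) * (a₀ + 1) + j = μ + (μ - j) * a₀ := by
    intro j hj
    have : (μ - j) * (a₀ + 1) = (μ - j) * a₀ + (μ - j) := by ring
    omega
  have hjunk : ∀ j, j ≤ μ → ∀ r : R',
      c' 1 ^ ((μ - j) * (a₀ + 1)) * (c' 1 * r) * (c' 1 * cs 0) ^ j ∈ weightedIdealW cs w' T := by
    intro j hj r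
    have : c' 1 ^ ((μ - j) * (a₀ + 1)) * (c' 1 * r) * (c' 1 * cs 0) ^ j =
        1 * monom3 cs (ybexp j (μ + (μ - j) * a₀ + 1) 0) * r := by
      rw [monom3_ybexp, hcs1, pow_zero, mul_one, mul_pow, ← hlev j hj]
      ring
    rw [this]; exact hmon_mem _ _ _ (hjunk_wt j hj)
  have hpiece : ∀ j ∈ Finset.range μ, piece j -
      φ (c 1) ^ μ * eval cs (if j ∈ Bs then (if val j = mstar then monomial (eOf j) (vOf j) else 0) else 0) ∈
        weightedIdealW cs w' T := by
    intro j hj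
    have hjμ : j < μ := Finset.mem_range.mp hj
    by_cases hjB : j ∈ Bs
    · rw [if_pos hjB]
      show c' 1 ^ ((μ - j) * (a₀ + 1)) * Polynomial.eval₂ φ t (nrShiftCoeff G Ψ μ j) * (c' 1 * cs 0) ^ j - _ ∈ _
      rw [hevalOf j hjB, mul_add, add_mul]
      have hmain_eq : c' 1 ^ ((μ - j) * (a₀ + 1)) * (c' 2 ^ sOf j * vOf j) * (c' 1 * cs 0) ^ j =
          φ (c 1) ^ μ * monom3 cs (eOf j) * vOf j := by
        simp only [eOf, monom3_ybexp, hcs1, hcs2, ← h₁]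
        rw [mul_pow]
        have : c' 1 ^ ((μ - j) * (a₀ + 1)) * c' 1 ^ j = c' 1 ^ μ * c' 1 ^ ((μ - j) * a₀) := by
          rw [← pow_add, ← pow_add, hlev j hjμ.le]
        calc c' 1 ^ ((μ - j) * (a₀ + 1)) * (c' 2 ^ sOf j * vOf j) * (c' 1 ^ j * cs 0 ^ j)
            = (c' 1 ^ ((μ - j) * (a₀ + 1)) * c' 1 ^ j) * cs 0 ^ j * c' 2 ^ sOf j * vOf j := by ring
          _ = c' 1 ^ μ * c' 1 ^ ((μ - j) * a₀) * cs 0 ^ j * c' 2 ^ sOf j * vOf j := by rw [this]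
          _ = c' 1 ^ μ * (cs 0 ^ j * cs 1 ^ ((μ - j) * a₀) * cs 2 ^ sOf j) * vOf j := by rw [hcs1, hcs2]; ring
      rw [hmain_eq]
      by_cases hv : val j = mstar
      · rw [if_pos hv, eval_monomial_eq_monom3]
        have : φ (c 1) ^ μ * monom3 cs (eOf j) * vOf j +
            c' 1 ^ ((μ - j) * (a₀ + 1)) * (φ (c 1) * rOf j) * (c' 1 * cs 0) ^ j -
            φ (c 1) ^ μ * (vOf j * monom3 cs (eOf j)) =
            c' 1 ^ ((μ - j) * (a₀ + 1)) * (c' 1 * rOf j) * (c' 1 * cs 0) ^ j := by rw [← h₁]; ring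
        rw [this]; exact hjunk j hjμ.le _
      · rw [if_neg hv, map_zero, mul_zero, sub_zero]
        refine Ideal.add_mem _ ?_ (by rw [← h₁]; exact hjunk j hjμ.le _)
        have hmon : φ (c 1) ^ μ * monom3 cs (eOf j) = monom3 cs (eOf j + Finsupp.single 1 μ) := by
          rw [monom3_add]; simp [monom3, hcs1, h₁]; ring
        rw [hmon]
        have : monom3 cs (eOf j + Finsupp.single 1 μ) * vOf j =
            1 * monom3 cs (eOf j + Finsupp.single 1 μ) * vOf j := by ring
        rw [this]
        refine hmon_mem _ _ _ ?_
        rw [map_add, Finsupp.weight_apply w' (Finsupp.single 1 μ), Finsupp.sum_single_index (by simp),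
          smul_eq_mul]
        have := hweOf_gt j hjB hv
        have hw'1 : w' 1 = L * Ntil := by simp [hw'def, hL]
        rw [hw'1, hT]
        have : μ * (L * Ntil) = μ * (L * Ntil) := rfl
        omega
    · rw [if_neg hjB, map_zero, mul_zero, sub_zero]
      -- `Ḡ^Ψ_j = 0`: the coefficient lies in `φ(𝔪) R′ ⊆ (u₁′)`
      have hzero : Polynomial.map (residue R) (nrShiftCoeff G Ψ μ j) = 0 := by
        by_contra hne
        exact hjB (Finset.mem_filter.mpr ⟨hj, hne⟩)
      have hmem : Polynomial.eval₂ φ t (nrShiftCoeff G Ψ μ j) ∈ Ideal.span {φ (c 1)} :=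
        map_maximalIdeal_le_span_nr φ hgen h₀ ht
          (eval₂_mem_map_of_forall_coeff_mem φ ((polynomial_map_residue_eq_zero_iff _).mp hzero) t)
      obtain ⟨r, hr⟩ := Ideal.mem_span_singleton'.mp hmem
      show c' 1 ^ ((μ - j) * (a₀ + 1)) * Polynomial.eval₂ φ t (nrShiftCoeff G Ψ μ j) * (c' 1 * cs 0) ^ j ∈ _
      rw [← hr, mul_comm r, ← h₁]
      exact hjunk j hjμ.le r
  have hpiece_top : piece μ = φ (c 1) ^ μ * eval cs (monomial top (φ (F.coeff top))) := by
    show c' 1 ^ ((μ - μ) * (a₀ + 1)) * Polynomial.eval₂ φ t (nrShiftCoeff G Ψ μ μ) * (c' 1 * cs 0) ^ μ = _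
    rw [nrShiftCoeff_self, hG, nrFam_self, Polynomial.eval₂_C, Nat.sub_self, zero_mul, pow_zero, one_mul,
      eval_monomial_eq_monom3, htop, mul_pow, ← h₁]
    simp [monom3]; ring
  -- (P1) the rest terms
  have hrest : ∀ m ∈ (F.support.filter (fun m => ¬ face m)).erase top, term m ∈ weightedIdealW cs w' T := by
    intro m hm
    have hne := Finset.ne_of_mem_erase hm
    obtain ⟨hms, hnf⟩ := Finset.mem_filter.mp (Finset.mem_of_mem_erase hm)
    by_cases hm0 : m 0 < μ
    · exact hnonface m hms hm0 (fun h => hnf ⟨hm0, h⟩)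
    · exact hhigh m hms (by omega) hne
  -- assembling: `φ(F(c)) − (φ u₁)^μ F⋆(cs) ∈ F′_T`
  have hsplit_sum : (∑ m ∈ F.support, term m) =
      ((∑ m ∈ F.support.filter face, term m) + term top) +
        ∑ m ∈ (F.support.filter (fun m => ¬ face m)).erase top, term m := by
    rw [← Finset.sum_filter_add_sum_filter_not F.support face]
    by_cases htop_mem : top ∈ F.support.filter (fun m => ¬ face m)
    · rw [← Finset.add_sum_erase _ _ htop_mem]; ring
    · have h0 : term top = 0 := by
        have hns : top ∉ F.support := fun h => htop_mem (Finset.mem_filter.mpr ⟨h, htop_nface⟩)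
        show φ (F.coeff top) * _ * _ = 0
        rw [notMem_support_iff.mp hns, map_zero, zero_mul, zero_mul]
      rw [h0, add_zero, Finset.erase_eq_of_notMem htop_mem]
  have hFst_eval : φ (c 1) ^ μ * eval cs Fst =
      (∑ j ∈ Finset.range μ, φ (c 1) ^ μ *
        eval cs (if j ∈ Bs then (if val j = mstar then monomial (eOf j) (vOf j) else 0) else 0)) +
      φ (c 1) ^ μ * eval cs (monomial top (φ (F.coeff top))) := by
    rw [hFst, map_add, mul_add, map_sum]
    congr 1
    rw [Finset.mul_sum]
    have hsub : Bs ⊆ Finset.range μ := fun b hb => (Finset.mem_filter.mp hb).1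
    rw [← Finset.sum_subset hsub (fun j _ hjB => by rw [if_neg hjB, map_zero, mul_zero])]
    exact Finset.sum_congr rfl fun j hj => by rw [if_pos hj]
  have hmain : φ (eval c F) - φ (c 1) ^ μ * eval cs Fst ∈ weightedIdealW cs w' T := by
    rw [hφF, hsplit_sum, hLINE, hLINE_pieces, Finset.sum_range_succ, hFst_eval, hpiece_top]
    have : (∑ j ∈ Finset.range μ, piece j) + φ (c 1) ^ μ * eval cs (monomial top (φ (F.coeff top))) +
          (∑ m ∈ (F.support.filter (fun m => ¬ face m)).erase top, term m) -
        ((∑ j ∈ Finset.range μ, φ (c 1) ^ μ *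
            eval cs (if j ∈ Bs then (if val j = mstar then monomial (eOf j) (vOf j) else 0) else 0)) +
          φ (c 1) ^ μ * eval cs (monomial top (φ (F.coeff top)))) =
        (∑ j ∈ Finset.range μ, (piece j - φ (c 1) ^ μ *
            eval cs (if j ∈ Bs then (if val j = mstar then monomial (eOf j) (vOf j) else 0) else 0))) +
          ∑ m ∈ (F.support.filter (fun m => ¬ face m)).erase top, term m := by
      rw [Finset.sum_sub_distrib]; ring
    rw [this]
    exact Ideal.add_mem _ (Ideal.sum_mem _ fun j hj => hpiece j hj) (Ideal.sum_mem _ fun m hm => hrest m hm)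
  -- the remainder
  have hrem' : φ (f - eval c F) ∈ weightedIdealW cs w' T := by
    have h1 := map_pow_maximalIdeal_le_span φ (c' := ![c' 0, c' 1, t]) (by simpa using h₀)
      (by simpa using ht) hgen M (Ideal.mem_map_of_mem _ hFrem)
    obtain ⟨r, hr⟩ := Ideal.mem_span_singleton'.mp h1
    rw [← hr, ← h₁]
    refine Ideal.mul_mem_left _ _ (weightedIdealW_antitone cs w' ?_ (hu1_mem M))
    rw [hT, hℓ]
    have hℓΛ : w0' * μ ≤ Λ := by
      rw [hw0', hΛ]
      refine Nat.mul_le_mul_right _ ?_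
      have : Ntil * (δs - L) ≤ Ntil * δs := Nat.mul_le_mul_left _ (Nat.sub_le _ _)
      omega
    have h2 : (Λ + μ + 1) * (L * Ntil) ≤ M * (L * Ntil) := Nat.mul_le_mul_right _ hMΛ
    have h3 : (Λ + μ + 1) * (L * Ntil) = Λ * (L * Ntil) + μ * (L * Ntil) + L * Ntil := by ring
    have h4 : Λ ≤ Λ * (L * Ntil) := Nat.le_mul_of_pos_right _ (Nat.mul_pos hLpos (by omega))
    have h5 : 1 ≤ L * Ntil := Nat.mul_pos hLpos (by omega)
    omega
  -- dividing by `(φ u₁)^μ`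
  have hdiv : g - eval cs Fst ∈ weightedIdealW cs w' (ℓ + 1) := by
    have htot : φ (c 1) ^ μ * (g - eval cs Fst) ∈ weightedIdealW cs w' T := by
      have : φ (c 1) ^ μ * (g - eval cs Fst) =
          (φ (eval c F) - φ (c 1) ^ μ * eval cs Fst) + φ (f - eval c F) := by
        rw [map_sub, mul_sub, ← hg]; ring
      rw [this]; exact Ideal.add_mem _ hmain hrem'
    have hmon : φ (c 1) ^ μ = monom3 cs (Finsupp.single 1 μ) := by simp [monom3, hcs1, h₁]
    have hwt1 : Finsupp.weight w' (Finsupp.single 1 μ) = μ * (L * Ntil) := by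
      rw [Finsupp.weight_apply, Finsupp.sum_single_index (by simp), smul_eq_mul]
      simp [hw'def, hL]
    refine mem_weightedIdealW_of_monom3_mul_mem cs hgencs hdim' hw' (Finsupp.single 1 μ) ?_
    rw [hwt1, ← hmon, ← hT]; exact htot
  -- conclusion
  have hinit : IsInitialTerm cs w' g (eOf bst) := by
    refine ⟨Fst, ?_, ?_, ?_⟩
    · rw [hweOf_eq bst hbst rfl]; exact hFst_hom
    · rw [hFst_coeff]; exact hvOf bst hbst
    · rw [hweOf_eq bst hbst rfl]; exact hdiv
  refine ⟨eOf bst, ⟨mem_occ_of_isInitialTerm cs hgJ' hw' hinit, by simpa [eOf] using hbst_lt⟩, ?_, ?_⟩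
  · -- `spt₁ + L = δs`
    have hsf : sfac μ (eOf bst) = L / (μ - bst) := by rw [sfac]; rfl
    rw [spt₁, hsf, ha₀]
    show (μ - bst) * a₀ * (L / (μ - bst)) + L = L * (a₀ + 1)
    rw [mul_comm (μ - bst) a₀, mul_assoc, hsfac_eq bst hbst_lt]; ring
  · -- `d · spt₂ ≤ Γ′`
    have := hvalΓd bst hbst
    have hsf : sfac μ (eOf bst) = L / (μ - bst) := by rw [sfac]; rfl
    rw [spt₂, hsf]
    exact this

end RealizeShift

end Literature.AlgebraicGeometry.Resolution

end
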